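import Literature.AlgebraicGeometry.HodgeTheory.MotivatedClasses
import Literature.AlgebraicGeometry.HodgeTheory.FermatHypersurfaceReduction
import Literature.AlgebraicGeometry.HodgeTheory.IsoTransport
import Literature.AlgebraicGeometry.Motives.ComplexPointsManifold
import Literature.AlgebraicGeometry.Motives.SegreEmbedding
import Literature.AlgebraicTopology.SingularHomology.FundamentalClassProofs
import Literature.AlgebraicTopology.SingularHomology.FundamentalClassExistence
import HarnessLib

/-!
# Motivated classes transport along isomorphisms of smooth projective complex varieties

Family `hodge`, layer `Literature/AlgebraicGeometry/HodgeTheory`. Companion (theorems only) of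
`MotivatedClasses.lean` (André's motivated classes `A_motᵖ(X)_ℂ = motivatedClasses n X p` on the
real carriers `H²ᵖ(X(ℂ); ℂ)`, Y. André, *Pour une théorie inconditionnelle des motifs*, Publ. Math.
IHÉS 83 (1996), §2.1 Déf. 1). For an isomorphism `e : X' ≅ X` of smooth projective complex varieties
of dimension `n`, `e^* : H²ᵖ(X(ℂ); ℂ) → H²ᵖ(X'(ℂ); ℂ)` maps `A_motᵖ(X)_ℂ` onto `A_motᵖ(X')_ℂ`
(`motivatedClasses_map_of_iso`). This is tacit in the paper (everything there is functorial in the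
object of `𝒱`), and on the real carriers it is the bookkeeping needed wherever a variety is only
given up to isomorphism — fibres of families and of their base changes in the proof of the
deformation theorem, Thm. 0.5 (§5.1: "on peut remplacer `S` par `S'`"), file
`MotivatedClassesDeformation.lean`.

The generators of `A_motᵖ(X)_ℂ` are the classes `pr_{X*}(α ∪ *_L β)` (`IsMotivatedClass`), built
from the TOPOLOGICAL Gysin map `pr_{X*} = gysinMap μ ν pr_X(ℂ)` of `ℂ`-orientations `μ` of
`(X ⊗ Y)(ℂ)`, `ν` of `X(ℂ)` with Poincaré duality, a polarisation class `η` of `X ⊗ Y` with its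
Lefschetz involution `*_L`, and algebraic `α`, `β` on `X ⊗ Y`. Transport along `e` (and
`E = e ⊗ Y : X' ⊗ Y ≅ X ⊗ Y`) therefore needs, and this file proves:

* `HomologicalOrientation.fundamentalClass_comap_of_compactSpace`: `[Y]_{μ.comap h} = (h⁻¹)_* [X]_μ`
  for a homeomorphism `h : Y ≃ₜ X` onto a closed manifold (Hatcher Thm. 3.26 / Lemma 3.27: existence
  and uniqueness of fundamental classes, both PROVED in the tree; this is the tree's named fact
  `HomologicalOrientation.fundamentalClass_comap` in the closed case it is about);
* `HomologicalOrientation.HasPoincareDuality.comap`: Poincaré duality transports along `h`;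
* `map_gysinMap_of_homeomorph`: naturality of Gysin maps under homeomorphisms of source and target,
  `h_X^* (f_! y) = f'_! (h_Y^* y)` for `f ∘ h_Y = h_X ∘ f'` (Fulton, *Young Tableaux*, App. B (5):
  `f_!` is `f_*` read through Poincaré duality, and `f_*`, `⌢` are natural);
* `HasHardLefschetzProperty.map_of_iso`, `IsPolarizationClass.map_of_iso`,
  `lefschetzInvolution_map`: hard Lefschetz, polarisation classes and `*_L` commute with `e^*`
  (`Lʲ` is natural, `lefschetzPow_map`; rational and algebraic classes pull back,
  `IsRationalClass.map`, `mem_algebraicClasses_map_of_iso`);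
* `IsMotivatedClass.map_of_iso`, `map_mem_motivatedClasses_of_iso`, `motivatedClasses_map_of_iso`:
  the transport of generators, of the span, and the equality `e^*(A_motᵖ(X)_ℂ) = A_motᵖ(X')_ℂ`.

The invertibility of `e^*` (`complexBetti.map_bijective_of_iso`, `complexBetti.map_inv_map_hom_apply`,
`complexBetti.map_hom_map_inv_apply`) is proved in `HodgeTheory/IsoTransport` (light import cone);
the copies here are one-line aliases kept for their users.

## References

* [Andre1996Motifs] Y. André, Publ. Math. IHÉS 83 (1996) 5–49: §2.1 Déf. 1 (p. 14), §5.1 (p. 25).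
* [FultonYoungTableaux1997] W. Fulton, Young Tableaux, CUP 1997, App. B §B.1 (2), (5).
* [HatcherAT2002] A. Hatcher, Algebraic Topology, CUP 2002, §3.3 Thm. 3.26, Lemma 3.27, Thm. 3.30.
-/

noncomputable section

open CategoryTheory AlgebraicGeometry MonoidalCategory CartesianMonoidalCategory
open Literature.AlgebraicTopology.SingularHomology Literature.Geometry.Kaehler

universe u v

/-! ### Topology: fundamental classes, Poincaré duality and Gysin maps under homeomorphisms -/

namespace Literature.AlgebraicTopology.SingularHomology

section Comap

variable {R : Type v} [CommRing R]
variable {X Y X' Y' : Type u} [TopologicalSpace X] [TopologicalSpace Y] [TopologicalSpace X']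
  [TopologicalSpace Y'] {m n : ℕ}

/-- `h_* (h⁻¹)_* c = c` on `Hₙ(Y; R)` for a homeomorphism `h : X ≃ₜ Y`. [folklore] -/
theorem singularHomology.map_map_symm (h : X ≃ₜ Y) (k : ℕ) (c : singularHomology R R Y k) :
    singularHomology.map R R (h : C(X, Y)) k (singularHomology.map R R (h.symm : C(Y, X)) k c) = c := by
  rw [← singularHomology.mapIso_hom, ← singularHomology.mapIso_inv, ← ModuleCat.comp_apply,
    Iso.inv_hom_id, ModuleCat.id_apply]

/-- `(h⁻¹)_* h_* c = c` on `Hₙ(X; R)` for a homeomorphism `h : X ≃ₜ Y`. [folklore] -/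
theorem singularHomology.map_symm_map (h : X ≃ₜ Y) (k : ℕ) (c : singularHomology R R X k) :
    singularHomology.map R R (h.symm : C(Y, X)) k (singularHomology.map R R (h : C(X, Y)) k c) = c := by
  rw [← singularHomology.mapIso_inv, ← singularHomology.mapIso_hom, ← ModuleCat.comp_apply,
    Iso.hom_inv_id, ModuleCat.id_apply]

/-- `h^* (h⁻¹)^* a = a` on `Hⁿ(X; R)` for a homeomorphism `h : X ≃ₜ Y`. [folklore] -/
theorem singularCohomology.map_map_symm (h : X ≃ₜ Y) (k : ℕ) (a : singularCohomology R R X k) :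
    singularCohomology.map R R (h : C(X, Y)) k (singularCohomology.map R R (h.symm : C(Y, X)) k a) =
      a := by
  rw [← singularCohomology.mapIso_hom, ← singularCohomology.mapIso_inv, ← ModuleCat.comp_apply,
    Iso.inv_hom_id, ModuleCat.id_apply]

/-- `(h⁻¹)^* h^* a = a` on `Hⁿ(Y; R)` for a homeomorphism `h : X ≃ₜ Y`. [folklore] -/
theorem singularCohomology.map_symm_map (h : X ≃ₜ Y) (k : ℕ) (a : singularCohomology R R Y k) :
    singularCohomology.map R R (h.symm : C(Y, X)) k (singularCohomology.map R R (h : C(X, Y)) k a) =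
      a := by
  rw [← singularCohomology.mapIso_inv, ← singularCohomology.mapIso_hom, ← ModuleCat.comp_apply,
    Iso.hom_inv_id, ModuleCat.id_apply]

/-- `h_*` is injective on `Hₙ(X; R)` for a homeomorphism `h`. [folklore] -/
theorem singularHomology.map_injective_of_homeomorph (h : X ≃ₜ Y) (k : ℕ) :
    Function.Injective (singularHomology.map R R (h : C(X, Y)) k) :=
  Function.LeftInverse.injective (g := singularHomology.map R R (h.symm : C(Y, X)) k)
    (singularHomology.map_symm_map h k)

/-- **Homeomorphism invariance of the fundamental class** of a closed `R`-oriented manifold `X`: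
for `h : Y ≃ₜ X`, `[Y]_{μ.comap h} = (h⁻¹)_* [X]_μ` (the tree's named fact
`HomologicalOrientation.fundamentalClass_comap`, proved for `X` closed: `h_*` of any fundamental class
of `μ.comap h` is a fundamental class of `μ`, `isFundamentalClass_comap_iff`, and fundamental classes
of `μ` exist and are unique, Hatcher Thm. 3.26 (a) / Lemma 3.27 — the tree's PROVED
`isFundamentalClass_fundamentalClass_holds`, `IsFundamentalClass.unique_holds`).
[cite: HatcherAT2002, §3.3 Thm. 3.26 (a) and Lemma 3.27] -/
theorem HomologicalOrientation.fundamentalClass_comap_of_compactSpace [CompactSpace X] [T2Space X]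
    [ChartedSpace (EuclideanSpace ℝ (Fin n)) X] (μ : HomologicalOrientation R X n) (h : Y ≃ₜ X) :
    (μ.comap h).fundamentalClass =
      singularHomology.map R R (h.symm : C(X, Y)) n μ.fundamentalClass := by
  have hμ : IsFundamentalClass μ μ.fundamentalClass :=
    HomologicalOrientation.isFundamentalClass_fundamentalClass_holds n μ
  have hex : ∃ c', IsFundamentalClass (μ.comap h) c' := by
    refine ⟨singularHomology.map R R (h.symm : C(X, Y)) n μ.fundamentalClass, ?_⟩
    rw [isFundamentalClass_comap_iff, singularHomology.map_map_symm]
    exact hμ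
  have h1 := (isFundamentalClass_comap_iff μ h _).1
    (HomologicalOrientation.isFundamentalClass_fundamentalClass_of_exists hex)
  have h2 : singularHomology.map R R (h : C(Y, X)) n (μ.comap h).fundamentalClass =
      μ.fundamentalClass :=
    IsFundamentalClass.unique_holds R X n h1 hμ
  rw [← h2, singularHomology.map_symm_map]

/-- **Poincaré duality transports along homeomorphisms**: if `D_μ : Hᵖ(X; R) → H_q(X; R)` is
bijective for all `p + q = n` (`X` closed), so is `D_{μ.comap h}` on `Y` for `h : Y ≃ₜ X`, because
`h_* (D_{μ.comap h} (h^* a)) = D_μ a` (naturality of `⌢`, `capProduct_map`, and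
`[Y] = (h⁻¹)_* [X]`), with `h_*`, `h^*` bijective. [cite: HatcherAT2002, §3.3 Thm. 3.30] -/
theorem HomologicalOrientation.HasPoincareDuality.comap [CompactSpace X] [T2Space X]
    [ChartedSpace (EuclideanSpace ℝ (Fin n)) X] {μ : HomologicalOrientation R X n}
    (hμ : μ.HasPoincareDuality) (h : Y ≃ₜ X) : (μ.comap h).HasPoincareDuality := by
  intro p q hpq
  -- `h_* (D' (h^* a)) = D a`
  have key : ∀ a : singularCohomology R R X p,
      singularHomology.map R R (h : C(Y, X)) q
        (poincareDualityMap (μ.comap h) hpq (singularCohomology.map R R (h : C(Y, X)) p a)) =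
      poincareDualityMap μ hpq a := fun a => by
    rw [poincareDualityMap_apply, poincareDualityMap_apply,
      HomologicalOrientation.fundamentalClass_comap_of_compactSpace μ h, capProduct_map,
      singularHomology.map_map_symm]
  have hsurj : Function.Surjective (singularCohomology.map R R (h : C(Y, X)) p) := fun b =>
    ⟨singularCohomology.map R R (h.symm : C(X, Y)) p b, singularCohomology.map_map_symm h p b⟩
  constructor
  · intro b₁ b₂ hb
    obtain ⟨a₁, rfl⟩ := hsurj b₁
    obtain ⟨a₂, rfl⟩ := hsurj b₂
    have h' := congrArg (singularHomology.map R R (h : C(Y, X)) q) hb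
    rw [key, key] at h'
    rw [(hμ hpq).1 h']
  · intro c
    obtain ⟨a, ha⟩ := (hμ hpq).2 (singularHomology.map R R (h : C(Y, X)) q c)
    refine ⟨singularCohomology.map R R (h : C(Y, X)) p a, ?_⟩
    apply singularHomology.map_injective_of_homeomorph h q
    rw [key, ha]

/-- **Gysin maps are natural under homeomorphisms of source and target.** Let `f : Y → X` be a map
between closed `R`-oriented manifolds (`μ` on `Y` of dimension `m`, `ν` on `X` of dimension `n`, `ν`
satisfying Poincaré duality), and `h_Y : Y' ≃ₜ Y`, `h_X : X' ≃ₜ X`, `f' : Y' → X'` with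
`f ∘ h_Y = h_X ∘ f'`. Then for the transported orientations,
`h_X^* (f_! y) = f'_! (h_Y^* y)` in `Hᵇ(X'; R)` for every `y ∈ Hᵃ(Y; R)` (`a + q = m`, `b + q = n`):
`f_! = D_X⁻¹ ∘ f_* ∘ D_Y` (Fulton App. B (5)), and `f_*`, `⌢`, `[·]` are natural under `h_Y`, `h_X`.
Proof: by the uniqueness `eq_gysinMap_of_capProduct_eq`, after applying the injective `(h_X)_*`.
[cite: FultonYoungTableaux1997, Appendix B §B.1 (2) and (5)] [cite: HatcherAT2002, §3.3 Thm. 3.30] -/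
theorem map_gysinMap_of_homeomorph [CompactSpace X] [T2Space X]
    [ChartedSpace (EuclideanSpace ℝ (Fin n)) X] [CompactSpace Y] [T2Space Y]
    [ChartedSpace (EuclideanSpace ℝ (Fin m)) Y] (μ : HomologicalOrientation R Y m)
    (ν : HomologicalOrientation R X n) (hν : ν.HasPoincareDuality) (hY : Y' ≃ₜ Y) (hX : X' ≃ₜ X)
    (f : C(Y, X)) (f' : C(Y', X')) (hf : f.comp (hY : C(Y', Y)) = (hX : C(X', X)).comp f')
    {a b q : ℕ} (ha : a + q = m) (hb : b + q = n) (y : singularCohomology R R Y a) :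
    singularCohomology.map R R (hX : C(X', X)) b (gysinMap μ ν f ha hb y) =
      gysinMap (μ.comap hY) (ν.comap hX) f' ha hb (singularCohomology.map R R (hY : C(Y', Y)) a y) := by
  refine eq_gysinMap_of_capProduct_eq (hν.comap hX) f' ha hb ?_
  apply singularHomology.map_injective_of_homeomorph hX q
  rw [HomologicalOrientation.fundamentalClass_comap_of_compactSpace ν hX,
    HomologicalOrientation.fundamentalClass_comap_of_compactSpace μ hY, capProduct_map,
    singularHomology.map_map_symm, capProduct_gysinMap hν f ha hb, ← ModuleCat.comp_apply,
    ← singularHomology.map_comp, ← hf, singularHomology.map_comp, ModuleCat.comp_apply,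
    capProduct_map, singularHomology.map_map_symm]

end Comap

end Literature.AlgebraicTopology.SingularHomology

/-! ### Transport of the ingredients of `IsMotivatedClass` along isomorphisms of `ℂ`-varieties -/

namespace Literature.AlgebraicGeometry.HodgeTheory

section HodgeTheory

variable {n : ℕ} {X X' : Motives.SchemeOver ℂ}

/-- The homeomorphism `e(ℂ) : X'(ℂ) ≃ₜ X(ℂ)` of an isomorphism `e : X' ≅ X`, as a continuous map,
is `e.hom(ℂ)`. [folklore] -/
theorem _root_.Literature.AlgebraicGeometry.Motives.AlgPoints.coe_homeomorphOfIso_eq_mapContinuous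
    (e : X' ≅ X) :
    (Motives.AlgPoints.homeomorphOfIso (L := ℂ) e : C(Motives.ComplexPoints X', Motives.ComplexPoints X)) =
      Motives.AlgPoints.mapContinuous (L := ℂ) e.hom :=
  rfl

/-- `e^* : Hⁱ(X(ℂ); ℂ) → Hⁱ(X'(ℂ); ℂ)` is bijective for an isomorphism `e : X' ≅ X` (inverse
`(e⁻¹)^*`). ALIAS of `complexBetti.bijective_map_of_iso` (`HodgeTheory/IsoTransport`, which holds the
proof); kept under this name for its users — prefer `bijective_map_of_iso` in new files. [folklore] -/
theorem complexBetti.map_bijective_of_iso (e : X' ≅ X) (i : ℕ) :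
    Function.Bijective (complexBetti.map e.hom i) :=
  complexBetti.bijective_map_of_iso e i

/-- `e^* (e⁻¹)^* x = x` on `Hⁱ(X'(ℂ); ℂ)` for an isomorphism `e : X' ≅ X`. Duplicate of
`map_hom_map_inv_apply` (`FermatHypersurfaceReduction`, in the import closure; the two statements
agree definitionally; both are aliases of `CategoryTheory.Iso.complexBetti_map_hom_map_inv` of
`HodgeTheory/IsoTransport`); kept as a deprecated restatement (dedup-01097, 2026-08-16). [folklore] -/
@[deprecated Literature.AlgebraicGeometry.HodgeTheory.map_hom_map_inv_apply (since := "2026-08-16")]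
theorem complexBetti.map_hom_map_inv_apply (e : X' ≅ X) (i : ℕ) (x : complexBetti X' i) :
    complexBetti.map e.hom i (complexBetti.map e.inv i x) = x :=
  Literature.AlgebraicGeometry.HodgeTheory.map_hom_map_inv_apply e i x

/-- `(e⁻¹)^* e^* x = x` on `Hⁱ(X(ℂ); ℂ)` for an isomorphism `e : X' ≅ X`. ALIAS of the `simp` lemma
`CategoryTheory.Iso.complexBetti_map_inv_map_hom` (`HodgeTheory/IsoTransport`, which holds the
proof); kept for its users — prefer `e.complexBetti_map_inv_map_hom` in new files. [folklore] -/
theorem complexBetti.map_inv_map_hom_apply (e : X' ≅ X) (i : ℕ) (x : complexBetti X i) :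
    complexBetti.map e.inv i (complexBetti.map e.hom i x) = x :=
  e.complexBetti_map_inv_map_hom i x

/-- **Hard Lefschetz transports along isomorphisms**: if `η ∈ H²(X(ℂ); ℂ)` has the hard Lefschetz
property in dimension `d` and `e : X' ≅ X`, so does `e^* η` on `X'`: `Lʲ_{e^*η} ∘ e^* = e^* ∘ Lʲ_η`
(`lefschetzPow_map`) with `e^*` bijective. [cite: Andre1996Motifs, §1.1 (p. 10)] -/
theorem _root_.Literature.Geometry.Kaehler.HasHardLefschetzProperty.map_of_iso (e : X' ≅ X)
    {η : complexBetti X 2} {d : ℕ} (hL : HasHardLefschetzProperty η d) :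
    HasHardLefschetzProperty (complexBetti.map e.hom 2 η) d := by
  intro j k hjk
  have hcomm : lefschetzPow (complexBetti.map e.hom 2 η) j k ∘ complexBetti.map e.hom k =
      complexBetti.map e.hom (k + 2 * j) ∘ lefschetzPow η j k := by
    funext x
    exact (lefschetzPow_map _ η j k x).symm
  have hbij : Function.Bijective
      (lefschetzPow (complexBetti.map e.hom 2 η) j k ∘ complexBetti.map e.hom k) := by
    rw [hcomm]
    exact (complexBetti.map_bijective_of_iso e _).comp (hL j k hjk)
  exact (Function.Bijective.of_comp_iff _ (complexBetti.map_bijective_of_iso e k)).mp hbij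

/-- **Polarisation classes transport along isomorphisms** of smooth projective complex varieties:
`e^* η` is rational (`IsRationalClass.map`), supported on a divisor
(`mem_algebraicClasses_map_of_iso`) and hard Lefschetz (`HasHardLefschetzProperty.map_of_iso`)
when `η` is. [cite: Andre1996Motifs, §1.1 (p. 10)] -/
theorem IsPolarizationClass.map_of_iso {d d' N : ℕ} (hX : Motives.IsSmoothProjective d X)
    (hX' : Motives.IsSmoothProjective d' X') (e : X' ≅ X) {η : complexBetti X 2}
    (hη : IsPolarizationClass N X η) : IsPolarizationClass N X' (complexBetti.map e.hom 2 η) where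
  isRationalClass := hη.isRationalClass.map _
  mem_algebraicClasses := mem_algebraicClasses_map_of_iso (p := 1) hX hX' e hη.mem_algebraicClasses
  hasHardLefschetz := hη.hasHardLefschetz.map_of_iso e

/-- **The Lefschetz involution commutes with pull-backs**: for `φ : X' ⟶ X` and `η ∈ H²(X(ℂ); ℂ)`
such that both `η` and `φ^* η` have the hard Lefschetz property in dimension `d` (e.g. `φ` an
isomorphism, `HasHardLefschetzProperty.map_of_iso`), `φ^* (*_{L_η} x) = *_{L_{φ^*η}} (φ^* x)` in
every degree: below the middle degree both sides are `L^{d-a}` (`lefschetzPow_map`), above it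
`x = Lʲ x₀` and both sides are `φ^* x₀`. [cite: Andre1996Motifs, §1.1 (p. 10) and §3.2 Remarque (p. 21)] -/
theorem lefschetzInvolution_map (φ : X' ⟶ X) {η : complexBetti X 2} {d : ℕ}
    (hL : HasHardLefschetzProperty η d) (hL' : HasHardLefschetzProperty (complexBetti.map φ 2 η) d)
    {a b : ℕ} (hab : a + b = 2 * d) (x : complexBetti X a) :
    complexBetti.map φ b (lefschetzInvolution hL hab x) =
      lefschetzInvolution hL' hab (complexBetti.map φ a x) := by
  by_cases h : a ≤ d
  · obtain ⟨j, hj⟩ : ∃ j, a + j = d := ⟨d - a, by omega⟩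
    obtain rfl : b = a + 2 * j := by omega
    rw [lefschetzInvolution_apply_of_le hL hj, lefschetzInvolution_apply_of_le hL' hj]
    exact lefschetzPow_map _ η j a x
  · obtain ⟨j, hj⟩ : ∃ j, b + j = d := ⟨d - b, by omega⟩
    obtain rfl : a = b + 2 * j := by omega
    obtain ⟨x₀, rfl⟩ := (hL j b hj).2 x
    rw [lefschetzInvolution_lefschetzPow hL hj hab x₀, lefschetzPow_map,
      lefschetzInvolution_lefschetzPow hL' hj hab]

/-! ### Motivated classes transport along isomorphisms -/

/-- `pr_X(ℂ) ∘ (e ⊗ Y)(ℂ) = e(ℂ) ∘ pr_{X'}(ℂ)` for `e : X' ≅ X` (`(e ▷ Y) ≫ pr_X = pr_{X'} ≫ e`,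
Mathlib `whiskerRight_fst`, on complex points). [folklore] -/
theorem mapContinuous_fst_comp_homeomorphOfIso_whiskerRightIso (e : X' ≅ X)
    (Y : Motives.SchemeOver ℂ) :
    (Motives.AlgPoints.mapContinuous (L := ℂ) (fst X Y)).comp
        (Motives.AlgPoints.homeomorphOfIso (L := ℂ) (whiskerRightIso e Y) :
          C(Motives.ComplexPoints (X' ⊗ Y), Motives.ComplexPoints (X ⊗ Y))) =
      (Motives.AlgPoints.homeomorphOfIso (L := ℂ) e :
          C(Motives.ComplexPoints X', Motives.ComplexPoints X)).comp
        (Motives.AlgPoints.mapContinuous (L := ℂ) (fst X' Y)) := by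
  refine ContinuousMap.ext fun P => ?_
  change Motives.AlgPoints.map (fst X Y) (Motives.AlgPoints.map (whiskerRightIso e Y).hom P) =
    Motives.AlgPoints.map e.hom (Motives.AlgPoints.map (fst X' Y) P)
  rw [← Motives.AlgPoints.map_comp_apply, ← Motives.AlgPoints.map_comp_apply, whiskerRightIso_hom,
    whiskerRight_fst]

/-- **André's generator `pr_{X*}(α ∪ *_L β)` pulled back along `e : X' ≅ X`**, for `X`, `Y` smooth
projective of dimensions `n`, `m`, orientations `μ` of `(X ⊗ Y)(ℂ)`, `ν` of `X(ℂ)` with `ν` satisfying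
Poincaré duality, `η ∈ H²((X ⊗ Y)(ℂ))` hard Lefschetz in dimension `n + m` together with
`E^* η`, `E = e ⊗ Y`: `e^* pr_{X*}(α ∪ *_L β) = pr_{X'*}(E^* α ∪ *_{L'} E^* β)`, the right-hand side
formed with the transported orientations `μ.comap E(ℂ)`, `ν.comap e(ℂ)` — Gysin maps, cup products
and `*_L` are natural (`map_gysinMap_of_homeomorph` with `pr_X ∘ E = e ∘ pr_{X'}`, `cupProduct_map`,
`lefschetzInvolution_map`). [cite: Andre1996Motifs, §2.1 Déf. 1 (p. 14)]
[cite: FultonYoungTableaux1997, Appendix B §B.1 (5)] -/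
theorem map_gysinMap_cupProduct_lefschetzInvolution_of_iso {m : ℕ} {Y : Motives.SchemeOver ℂ}
    (hX : Motives.IsSmoothProjective n X) (hY : Motives.IsSmoothProjective m Y) (e : X' ≅ X)
    (μ : HomologicalOrientation ℂ (Motives.ComplexPoints (X ⊗ Y)) (2 * (n + m)))
    (ν : HomologicalOrientation ℂ (Motives.ComplexPoints X) (2 * n)) (hν : ν.HasPoincareDuality)
    {η : complexBetti (X ⊗ Y) 2} (hL : HasHardLefschetzProperty η (n + m))
    (hL' : HasHardLefschetzProperty (complexBetti.map (whiskerRightIso e Y).hom 2 η) (n + m))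
    {p a b b' q : ℕ} (h₁ : 2 * (p + m) + 2 * q = 2 * (n + m)) (h₂ : 2 * p + 2 * q = 2 * n)
    (h₃ : 2 * a + 2 * b' = 2 * (p + m)) (h₄ : 2 * b + 2 * b' = 2 * (n + m))
    (α : complexBetti (X ⊗ Y) (2 * a)) (β : complexBetti (X ⊗ Y) (2 * b)) :
    complexBetti.map e.hom (2 * p)
        (gysinMap μ ν (Motives.AlgPoints.mapContinuous (L := ℂ) (fst X Y)) h₁ h₂
          (cupProduct h₃ α (lefschetzInvolution hL h₄ β))) =
      gysinMap (μ.comap (Motives.AlgPoints.homeomorphOfIso (L := ℂ) (whiskerRightIso e Y)))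
        (ν.comap (Motives.AlgPoints.homeomorphOfIso (L := ℂ) e))
        (Motives.AlgPoints.mapContinuous (L := ℂ) (fst X' Y)) h₁ h₂
        (cupProduct h₃ (complexBetti.map (whiskerRightIso e Y).hom (2 * a) α)
          (lefschetzInvolution hL' h₄ (complexBetti.map (whiskerRightIso e Y).hom (2 * b) β))) := by
  have hXY : Motives.IsSmoothProjective (n + m) (X ⊗ Y) := Motives.IsSmoothProjective.tensor_holds hX hY
  letI := hX.chartedSpace
  haveI := Motives.ComplexPoints.compactSpace_of_isSmoothProjective hX
  haveI := Motives.ComplexPoints.t2Space_of_isSmoothProjective hX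
  letI := hXY.chartedSpace
  haveI := Motives.ComplexPoints.compactSpace_of_isSmoothProjective hXY
  haveI := Motives.ComplexPoints.t2Space_of_isSmoothProjective hXY
  have hmap : ∀ i, complexBetti.map e.hom i =
      singularCohomology.map ℂ ℂ (Motives.AlgPoints.homeomorphOfIso (L := ℂ) e :
        C(Motives.ComplexPoints X', Motives.ComplexPoints X)) i := fun i => rfl
  have hmapE : ∀ i, complexBetti.map (whiskerRightIso e Y).hom i =
      singularCohomology.map ℂ ℂ (Motives.AlgPoints.homeomorphOfIso (L := ℂ) (whiskerRightIso e Y) :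
        C(Motives.ComplexPoints (X' ⊗ Y), Motives.ComplexPoints (X ⊗ Y))) i := fun i => rfl
  rw [hmap, map_gysinMap_of_homeomorph μ ν hν (Motives.AlgPoints.homeomorphOfIso (L := ℂ) (whiskerRightIso e Y))
      (Motives.AlgPoints.homeomorphOfIso (L := ℂ) e) _ _
      (mapContinuous_fst_comp_homeomorphOfIso_whiskerRightIso e Y) h₁ h₂,
    cupProduct_map, ← hmapE, ← hmapE, lefschetzInvolution_map _ hL hL']

/-- **André's generators transport along isomorphisms.** Let `e : X' ≅ X` be an isomorphism of
smooth projective complex varieties of dimension `n` and `x = pr_{X*}(α ∪ *_L β)` a generator of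
`A_motᵖ(X)_ℂ` (`IsMotivatedClass`, auxiliary `Y`, orientations `μ`, `ν`, polarisation `η` of
`X ⊗ Y`, algebraic `α`, `β`). Then `e^* x` is the generator of `A_motᵖ(X')_ℂ` with the same `Y`, the
orientations transported along `E(ℂ)`, `e(ℂ)` for `E = e ⊗ Y : X' ⊗ Y ≅ X ⊗ Y` (Poincaré duality
transports, `HasPoincareDuality.comap`), the polarisation `E^* η` (`IsPolarizationClass.map_of_iso`)
and the algebraic classes `E^* α`, `E^* β` (`mem_algebraicClasses_map_of_iso`), by
`map_gysinMap_cupProduct_lefschetzInvolution_of_iso`. [cite: Andre1996Motifs, §2.1 Déf. 1 (p. 14)] -/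
theorem IsMotivatedClass.map_of_iso (hX : Motives.IsSmoothProjective n X)
    (hX' : Motives.IsSmoothProjective n X') (e : X' ≅ X) {p : ℕ} {x : complexBetti X (2 * p)}
    (hx : IsMotivatedClass n X p x) : IsMotivatedClass n X' p (complexBetti.map e.hom (2 * p) x) := by
  obtain ⟨m, Y, hY, μ, ν, hμ, hν, η, hη, a, b, b', q, hbb', hab, hq, α, β, hα, hβ, rfl⟩ := hx
  have hXY : Motives.IsSmoothProjective (n + m) (X ⊗ Y) := Motives.IsSmoothProjective.tensor_holds hX hY
  have hX'Y : Motives.IsSmoothProjective (n + m) (X' ⊗ Y) :=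
    Motives.IsSmoothProjective.tensor_holds hX' hY
  have hη' : IsPolarizationClass (n + m) (X' ⊗ Y) (complexBetti.map (whiskerRightIso e Y).hom 2 η) :=
    hη.map_of_iso hXY hX'Y (whiskerRightIso e Y)
  have hμ' : (μ.comap (Motives.AlgPoints.homeomorphOfIso (L := ℂ) (whiskerRightIso e Y))).HasPoincareDuality := by
    letI := hXY.chartedSpace
    haveI := Motives.ComplexPoints.compactSpace_of_isSmoothProjective hXY
    haveI := Motives.ComplexPoints.t2Space_of_isSmoothProjective hXY
    exact hμ.comap _
  have hν' : (ν.comap (Motives.AlgPoints.homeomorphOfIso (L := ℂ) e)).HasPoincareDuality := by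
    letI := hX.chartedSpace
    haveI := Motives.ComplexPoints.compactSpace_of_isSmoothProjective hX
    haveI := Motives.ComplexPoints.t2Space_of_isSmoothProjective hX
    exact hν.comap _
  refine ⟨m, Y, hY, _, _, hμ', hν', _, hη', a, b, b', q, hbb', hab, hq,
    complexBetti.map (whiskerRightIso e Y).hom (2 * a) α,
    complexBetti.map (whiskerRightIso e Y).hom (2 * b) β,
    mem_algebraicClasses_map_of_iso hXY hX'Y _ hα, mem_algebraicClasses_map_of_iso hXY hX'Y _ hβ, ?_⟩
  exact map_gysinMap_cupProduct_lefschetzInvolution_of_iso hX hY e μ ν hν hη.hasHardLefschetz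
    hη'.hasHardLefschetz _ _ _ _ α β

/-- **Motivated classes transport along isomorphisms**: for `e : X' ≅ X` an isomorphism of smooth
projective complex varieties of dimension `n`, `e^*(A_motᵖ(X)_ℂ) ⊆ A_motᵖ(X')_ℂ` (the span of the
transported generators, `IsMotivatedClass.map_of_iso`). [cite: Andre1996Motifs, §2.1 Déf. 1 (p. 14)] -/
theorem map_mem_motivatedClasses_of_iso (hX : Motives.IsSmoothProjective n X)
    (hX' : Motives.IsSmoothProjective n X') (e : X' ≅ X) {p : ℕ} {x : complexBetti X (2 * p)}
    (hx : x ∈ motivatedClasses n X p) :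
    complexBetti.map e.hom (2 * p) x ∈ motivatedClasses n X' p := by
  suffices h : motivatedClasses n X p ≤
      (motivatedClasses n X' p).comap (complexBetti.map e.hom (2 * p)).hom from h hx
  rw [motivatedClasses_le_iff]
  intro y hy
  exact (hy.map_of_iso hX hX' e).mem_motivatedClasses

/-- **`e^*(A_motᵖ(X)_ℂ) = A_motᵖ(X')_ℂ`** for an isomorphism `e : X' ≅ X` of smooth projective
complex varieties of dimension `n` (both inclusions from `map_mem_motivatedClasses_of_iso`, applied to
`e` and to `e⁻¹`). [cite: Andre1996Motifs, §2.1 Déf. 1 (p. 14)] -/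
theorem motivatedClasses_map_of_iso (hX : Motives.IsSmoothProjective n X)
    (hX' : Motives.IsSmoothProjective n X') (e : X' ≅ X) (p : ℕ) :
    (motivatedClasses n X p).map (complexBetti.map e.hom (2 * p)).hom = motivatedClasses n X' p := by
  refine le_antisymm ?_ fun x hx => ?_
  · rintro _ ⟨x, hx, rfl⟩
    exact map_mem_motivatedClasses_of_iso hX hX' e hx
  · refine ⟨complexBetti.map e.inv (2 * p) x, map_mem_motivatedClasses_of_iso hX' hX e.symm hx, ?_⟩
    exact map_hom_map_inv_apply e (2 * p) x

/-- Membership form: `e^* x ∈ A_motᵖ(X')_ℂ ↔ x ∈ A_motᵖ(X)_ℂ` for `e : X' ≅ X`.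
[cite: Andre1996Motifs, §2.1 Déf. 1 (p. 14)] -/
theorem map_mem_motivatedClasses_iff_of_iso (hX : Motives.IsSmoothProjective n X)
    (hX' : Motives.IsSmoothProjective n X') (e : X' ≅ X) {p : ℕ} (x : complexBetti X (2 * p)) :
    complexBetti.map e.hom (2 * p) x ∈ motivatedClasses n X' p ↔ x ∈ motivatedClasses n X p := by
  refine ⟨fun h => ?_, map_mem_motivatedClasses_of_iso hX hX' e⟩
  have h' := map_mem_motivatedClasses_of_iso hX' hX e.symm h
  rwa [Iso.symm_hom, complexBetti.map_inv_map_hom_apply] at h'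

end HodgeTheory

end Literature.AlgebraicGeometry.HodgeTheory

end
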